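import Summits.PneNP.PneNP.Theorems.KrwChromaticSteeringStrongCompositionLradState
import Summits.PneNP.PneNP.Theorems.KrwChromaticSteeringStrongCompositionLrbClassDefs

/-!
# Crux line `lrb-gluing` (stmt-PneNP-18538), the glued adversary on LRB I: row split and the TRANSFER LEMMA of the type-B node

The one new step of the LRB adversary relative to the PROVED rung C1|LRAD (`KrwChromaticSteeringStrongCompositionLrad*.lean`):
a single-row test on an ALGEBRAIC row `i` (a row already met by affine tests, load `λ_i = rowLoad E i`, `λ_i + k ≤ q`).  The glued
LRAD invariant `KrwLrad.InvAt` is kept VERBATIM; the type-B node is handled by the landed LRAD row step run at the typing in which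
row `i` is already combinatorial, preceded by the transfer proved here (memo `Cruxes/StrongComposition/LensBarrierP4g20.md` §2,
lead g0's hand-off `Cruxes/StrongComposition/LradLandedHandoffG0.md` §2):

* §1 ROW SPLIT (`KrwLrb.extSys` / `KrwLrb.intSys` of `…LrbClassDefs.lean`): parity splits over the row boundary
  (`parityOn_split`); the external system has load `0` on row `i` and the loads of `E` elsewhere; a solution of `E` solves the
  external system corrected by its own row; **split identity** `sat_of_extSys`: external system + internal parities on row `i`
  ⟹ `E`.
* §2 `transferB` — **the type-B node costs nothing**: `τ i = algebraic → InvAt g q (update τ i combinatorial) N → InvAt g q τ N`.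
  Given a state with row `i` algebraic, split at row `i` with the COMMON internal parities of one solution `X₀` of the common
  system `E` (both players alike — no per-player twist), move the internal system into both row-sets (`V_i`, codimension
  `≤ λ_i`), and run `N` on the restricted state: fibred matrix sets shrink (validity inherited), realisable label columns are
  unchanged (`AffGeneric g r`, `λ_i + r + 1 ≤ n`: both `g`-fibres meet `V_i`), the new row game
  `(V_i ∩ g⁻¹α) × (V_i ∩ g⁻¹¬α)` is `(q − λ_i)`-hard (`KrwLrb.SubspaceHard`, `hard_swap` for `α = false`), and with
  `K ↦ min K k ≤ k ≤ q − λ_i` the potential `ℓ + min K k` is unchanged.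

FRONTIER rung of the KRW programme (class-restricted strong composition, Meir 2023); C1 itself stays open; nothing here bears on
P vs NP.
-/

set_option linter.dupNamespace false -- `Summit.PneNP.PneNP.…`: summit = sub-problem name (D-0017 single-conjunct layout)
set_option autoImplicit false

namespace Summit.PneNP.PneNP.Theorems.KrwLrb

open Literature.Computability.Complexity
open Summit.PneNP.PneNP.Theorems.KrwLrad

/-! ## §1  Row split of an affine system at a row boundary -/
section RowSplit

variable {m n : ℕ}

/-- Replacing row `i` of `X` by itself does nothing. -/
theorem setRow_row_self (X : Fin m × Fin n → Bool) (i : Fin m) : setRow X i (row X i) = X := by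
  funext p
  rcases p with ⟨i', j⟩
  by_cases h : i' = i
  · subst h; simp [setRow, row]
  · simp [setRow, h]

/-- Parity of a support splits into its row-`i` part and its off-row-`i` part. -/
theorem parityOn_split (S : Finset (Fin m × Fin n)) (X : Fin m × Fin n → Bool) (i : Fin m) :
    parityOn S X = Bool.xor (rowParity (rowSupp S i) (row X i)) (parityOn (offRow S i) X) := by
  conv_lhs => rw [← setRow_row_self X i]
  exact parityOn_setRow S X i (row X i)

/-- The rows an off-row-`i` support touches: those of the support, except `i`. -/
theorem mem_eqRows_offRow {U : Finset (Fin m × Fin n)} {i i' : Fin m} :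
    i' ∈ eqRows (offRow U i) ↔ i' ∈ eqRows U ∧ i' ≠ i := by
  simp only [eqRows, offRow, Finset.mem_image, Finset.mem_filter, Prod.exists, exists_and_right,
    exists_eq_right]

/-- The external system does not touch row `i`. -/
theorem rowLoad_extSys_self (E : AffSys m n) (i : Fin m) (y : Fin n → Bool) :
    rowLoad (extSys E i y) i = 0 := by
  unfold rowLoad extSys
  rw [List.length_eq_zero_iff, List.filter_eq_nil_iff]
  intro e he
  simp only [List.mem_map] at he
  obtain ⟨e₀, -, rfl⟩ := he
  simp [mem_eqRows_offRow]

/-- The external system has the loads of `E` on every other row. -/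
theorem rowLoad_extSys_of_ne (E : AffSys m n) {i i' : Fin m} (y : Fin n → Bool) (h : i' ≠ i) :
    rowLoad (extSys E i y) i' = rowLoad E i' := by
  unfold rowLoad extSys
  rw [List.filter_map, List.length_map]
  congr 1
  apply List.filter_congr
  intro e _
  simp [Function.comp, mem_eqRows_offRow, h]

/-- The internal system has `rowLoad E i` equations. -/
theorem length_intSys (E : AffSys m n) (i : Fin m) (y : Fin n → Bool) :
    (intSys E i y).length = rowLoad E i := by
  unfold intSys
  rw [List.length_map, length_touching]

/-- The reference row solves the internal system. -/
theorem self_sol_intSys (E : AffSys m n) (i : Fin m) (y : Fin n → Bool) :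
    ∀ e ∈ intSys E i y, rowParity e.1 y = e.2 := by
  intro e he
  simp only [intSys, List.mem_map] at he
  obtain ⟨e₀, -, rfl⟩ := he
  rfl

/-- A solution of `E` solves the external system corrected by its own row `i`. -/
theorem sat_extSys_self {E : AffSys m n} {X : Fin m × Fin n → Bool} (hX : Sat E X) (i : Fin m) :
    Sat (extSys E i (row X i)) X := by
  intro e he
  simp only [extSys, List.mem_map] at he
  obtain ⟨e₀, he₀, rfl⟩ := he
  have h := hX e₀ he₀
  rw [parityOn_split e₀.1 X i] at h
  simp only
  rw [← h]
  cases rowParity (rowSupp e₀.1 i) (row X i) <;> cases parityOn (offRow e₀.1 i) X <;> rfl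

/-- **The split identity**: a matrix solving the external system whose row `i` solves the internal system solves `E`. -/
theorem sat_of_extSys {E : AffSys m n} {i : Fin m} {y : Fin n → Bool} {X : Fin m × Fin n → Bool}
    (hext : Sat (extSys E i y) X) (hint : ∀ e ∈ intSys E i y, rowParity e.1 (row X i) = e.2) :
    Sat E X := by
  intro e he
  have h1 : parityOn (offRow e.1 i) X = Bool.xor e.2 (rowParity (rowSupp e.1 i) y) :=
    hext _ (List.mem_map.2 ⟨e, he, rfl⟩)
  have h2 : rowParity (rowSupp e.1 i) (row X i) = rowParity (rowSupp e.1 i) y := by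
    by_cases ht : i ∈ eqRows e.1
    · exact hint _ (List.mem_map.2 ⟨e, List.mem_filter.2 ⟨he, by simpa using ht⟩, rfl⟩)
    · rw [rowSupp_eq_empty ht, rowParity_empty, rowParity_empty]
  rw [parityOn_split e.1 X i, h1, h2]
  cases e.2 <;> cases rowParity (rowSupp e.1 i) y <;> rfl

end RowSplit

/-! ## §2  The transfer lemma (type-B node) -/

section Transfer

variable {m n : ℕ} {g : (Fin n → Bool) → Bool} {q : ℕ}

/-- Role swap: a hard rectangle stays hard with the players exchanged (`KWTree.swap`). -/
theorem hard_swap {ι : Type*} {A B : Set (ι → Bool)} {ℓ : ℕ} (h : Hard A B ℓ) : Hard B A ℓ := by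
  intro Q hQ
  have hsol : SolvesRect Q.swap A B := by
    intro a ha b hb
    rw [KWTree.run_swap]
    exact fun h' => hQ b hb a ha h'.symm
  simpa using h Q.swap hsol

/-- Realisable label columns do not change when a `univ` row-set is replaced by a set meeting both `g`-fibres. -/
theorem AE_update_of_univ {A : Set (Fin m → Bool)} {S : Fin m → Set (Fin n → Bool)} {i : Fin m}
    (hSi : S i = Set.univ) {V : Set (Fin n → Bool)} (hV : ∀ β, ∃ x ∈ V, g x = β) :
    AE g A (Function.update S i V) = AE g A S := by
  ext a
  simp only [AE, Set.mem_setOf_eq]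
  refine and_congr_right fun _ => forall_congr' fun i' => ?_
  by_cases h : i' = i
  · subst h
    rw [Function.update_self, hSi]
    exact ⟨fun _ => (hV (a i')).imp fun x ⟨_, hx⟩ => ⟨Set.mem_univ _, hx⟩,
      fun _ => hV (a i')⟩
  · rw [Function.update_of_ne h]

/-- The row game of the replaced row. -/
theorem RA_update_self (S : Fin m → Set (Fin n → Bool)) (i : Fin m) (V : Set (Fin n → Bool)) (α : Bool) :
    RA g (Function.update S i V) i α = V ∩ {x | g x = α} := by
  simp [RA]

/-- Row games of the other rows are unchanged. -/
theorem RA_update_of_ne (S : Fin m → Set (Fin n → Bool)) {i i' : Fin m} (V : Set (Fin n → Bool)) (α : Bool)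
    (h : i' ≠ i) : RA g (Function.update S i V) i' α = RA g S i' α := by
  simp [RA, Function.update_of_ne h]

/-- **TRANSFER LEMMA (the type-B node costs nothing).**  If the glued invariant holds for a subtree `N` from a typing in which
row `i` is combinatorial, it holds from the typing in which row `i` is algebraic: given a state with row `i` algebraic (both
row-sets `univ`, load `λ_i`, `λ_i + k ≤ q`), split every equation at the row-`i` boundary with the COMMON internal parities of
one solution `X₀` (`extSys`), move the internal system (`intSys`, `λ_i` equations) into both players' row-set `V_i`, and run `N`
on the restricted state: the fibred matrix sets only shrink (validity inherited), the realisable label columns are unchanged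
(`AffGeneric`: both `g`-fibres meet `V_i` since `λ_i + r + 1 ≤ n`), the new row game `(V_i ∩ g⁻¹α) × (V_i ∩ g⁻¹¬α)` is
`(q − λ_i)`-hard (`SubspaceHard`), and with `K ↦ min K k ≤ k ≤ q − λ_i` the potential `ℓ + min K k` is unchanged. -/
theorem transferB {r : ℕ} (hgen : AffGeneric g r) (hqr : q + r + 1 ≤ n) (hsub : SubspaceHard g q)
    {τ : Fin m → RowType} {i : Fin m} (hτi : τ i = RowType.algebraic) {N : KWTree (Fin m × Fin n)}
    (hI : InvAt g q (Function.update τ i RowType.combinatorial) N) : InvAt g q τ N := by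
  classical
  intro A B S T E k hst hsat hload hV hD hneA hneB ℓ K rr hL hR hK
  obtain ⟨X₀, hX₀⟩ := hsat
  have hne : τ i ≠ RowType.combinatorial := by rw [hτi]; exact fun h => RowType.noConfusion h
  have hSi : S i = Set.univ := ((hst i).2 hne).1
  have hTi : T i = Set.univ := ((hst i).2 hne).2
  have hki : k ≤ q - rowLoad E i := by have := hload i; omega
  -- the split
  set y : Fin n → Bool := row X₀ i with hy
  set E' : AffSys m n := extSys E i y with hE'
  set F : List (Finset (Fin n) × Bool) := intSys E i y with hF
  set V : Set (Fin n → Bool) := {x | ∀ e ∈ F, rowParity e.1 x = e.2} with hVdef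
  set S' : Fin m → Set (Fin n → Bool) := Function.update S i V with hS'
  set T' : Fin m → Set (Fin n → Bool) := Function.update T i V with hT'
  have hFlen : F.length = rowLoad E i := length_intSys E i y
  have hyV : y ∈ V := self_sol_intSys E i y
  have hVg : ∀ β, ∃ x ∈ V, g x = β := fun β => by
    obtain ⟨x, hx, hgx⟩ := hgen F (by have := hload i; omega) ⟨y, hyV⟩ β
    exact ⟨x, hx, hgx⟩
  -- the new state is a state for the typing with row `i` combinatorial
  have hst' : StateOK (Function.update τ i RowType.combinatorial) S' T' E' := by
    intro i'
    by_cases h : i' = i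
    · subst h
      rw [Function.update_self]
      exact ⟨fun _ => rowLoad_extSys_self E i' y, fun h' => (h' rfl).elim⟩
    · rw [Function.update_of_ne h, hS', hT', Function.update_of_ne h, Function.update_of_ne h, hE',
        rowLoad_extSys_of_ne E y h]
      exact hst i'
  have hsat' : ∃ X, Sat E' X := ⟨X₀, sat_extSys_self hX₀ i⟩
  have hload' : ∀ i', rowLoad E' i' + k ≤ q := by
    intro i'
    by_cases h : i' = i
    · subst h; rw [hE', rowLoad_extSys_self]; omega
    · rw [hE', rowLoad_extSys_of_ne E y h]; exact hload i'
  -- restriction of the fibred matrix sets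
  have hsubX : ∀ (C : Set (Fin m → Bool)) (R : Fin m → Set (Fin n → Bool)), R i = Set.univ →
      XSetE g C (Function.update R i V) E' ⊆ XSetE g C R E := by
    intro C R hRi X hX
    obtain ⟨hlab, hrows, hE⟩ := hX
    refine ⟨hlab, fun i' => ?_, ?_⟩
    · by_cases h : i' = i
      · subst h; rw [hRi]; exact Set.mem_univ _
      · have := hrows i'; rwa [Function.update_of_ne h] at this
    · have hi := hrows i
      rw [Function.update_self] at hi
      exact sat_of_extSys hE hi
  have hV' : ValidOnE g N A B S' T' E' := fun X hX Y hY =>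
    hV X (hsubX A S hSi hX) Y (hsubX B T hTi hY)
  have hAE_A : AE g A S' = AE g A S := AE_update_of_univ hSi hVg
  have hAE_B : AE g B T' = AE g B T := AE_update_of_univ hTi hVg
  -- the row games
  have hrow : ∀ α : Bool, Hard (V ∩ {x | g x = α}) (V ∩ {x | g x = !α}) (q - rowLoad E i) := by
    have h0 := hsub F (by have := hload i; omega) ⟨y, hyV⟩
    rw [hFlen] at h0
    intro α
    cases α
    · exact hard_swap h0
    · exact h0
  let r' : Fin m → Bool → ℕ := fun i' α => if i' = i then q - rowLoad E i else rr i' α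
  have hR' : ∀ i' α, Alive g A B S' T' i' α → Hard (RA g S' i' α) (RA g T' i' (!α)) (r' i' α) := by
    intro i' α hal
    have hal0 : Alive g A B S T i' α := hal.mono hAE_A.le hAE_B.le
    by_cases h : i' = i
    · subst h
      have hr' : r' i' α = q - rowLoad E i' := by simp [r']
      rw [hr', hS', hT', RA_update_self, RA_update_self]
      exact hrow α
    · have hr' : r' i' α = rr i' α := by simp [r', h]
      rw [hr', hS', hT', RA_update_of_ne _ _ _ h, RA_update_of_ne _ _ _ h]
      exact hR i' α hal0
  have hK' : ∀ i' α, Alive g A B S' T' i' α →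
      min K k ≤ r' i' α + cst (AE g A S') i' + cst (AE g B T') i' := by
    intro i' α hal
    have hal0 : Alive g A B S T i' α := hal.mono hAE_A.le hAE_B.le
    by_cases h : i' = i
    · subst h
      have hr' : r' i' α = q - rowLoad E i' := by simp [r']
      rw [hr']
      omega
    · have hr' : r' i' α = rr i' α := by simp [r', h]
      have hk := hK i' α hal0
      rw [hr', hAE_A, hAE_B]
      omega
  have hmain := hI A B S' T' E' k hst' hsat' hload' hV' (by rw [hAE_A, hAE_B]; exact hD)
    (by rw [hAE_A]; exact hneA) (by rw [hAE_B]; exact hneB) ℓ (min K k) r' (by rw [hAE_A, hAE_B]; exact hL)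
    hR' hK'
  rwa [Nat.min_assoc, Nat.min_self] at hmain

end Transfer

end Summit.PneNP.PneNP.Theorems.KrwLrb
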